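import Summits.AtomisticToContinuum.Crystallization.Theorems.ThreeConeCertificateSlackRigidityLawEnergy
import Summits.AtomisticToContinuum.Crystallization.Theorems.ThreeConeCertificateSlackRigidityLawBad
import HarnessLib

/-!
# Law rigidity, selection: a positive bad-root probability yields large near-minimal clusters with a bad fraction

Support file for the crux `ThreeConeCertificate.SlackRigidity` (stmt-AtomisticToContinuum-11960), line
`ekeland-surgery-parity`, lead c14's law-rigidity programme.

**`exists_badCluster`.**  Let `P` be a point-stationary probability law, a.s. rooted `δ`-hard-core, with
`E_P[h] ≤ e*`, and let `G` be a measurable version of the `(R, ε)`-good-root event with `P(Gᶜ) ≠ 0`.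
Then there is `b > 0` such that for every slack `η > 0` and size `M` there is a finite cluster `T`
(a finset of `ℝ³`) with `#T ≥ M`, energy `𝓔(T) ≤ #T · e* + η #T`, and at least `b · #T` points that are
`(R, ε)`-bad WITHIN `T`.

Proof (selection by averaging, no ergodic decomposition).  With the grid mesh `L` large, the two
cell-averaging identities give `E_P[∫ cellAvg f_B] = P(Gᶜ) · vol(deep) ≥ β V/2`
(`SlackRigidityLawBad`) and `E_P[∫ cellAvg f_E] ≤ V · ofReal (e* + C_δ) + E_P[err_L]/12`
(`SlackRigidityLawEnergy`), while pointwise `cellAvg f_B ≤` bad fraction of the root's cluster and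
`cellAvg f_E = ofReal (𝓔(T)/#T + C_δ)`.  If NO cluster had the three properties, then at every
(configuration, phase) either the bad fraction is `< b` or the excess rate `𝓔(T)/#T - e*` exceeds
`τ = min η τ_M` (small clusters have excess rate `> τ_M` by STRICT subadditivity
`E(2n) < 2 E(n)`, `lt_excessRate`), so pointwise `cellAvg f_B ≤ ofReal b + (cellAvg f_E - c)/ofReal τ`;
integrating (only constants need to be measurable) gives `β V/2 < β V/4 + β V/8`, absurd.
All `[folklore]`.
-/

noncomputable section

open MeasureTheory Filter Set
open scoped ENNReal BigOperators Topology

namespace Summit.AtomisticToContinuum.Crystallization.Theorems.SlackRigidityLawSelection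

open Literature.Probability.Process
open Literature.MathematicalPhysics.StatisticalMechanics (PeriodicConfiguration lennardJones interactionEnergy
  groundStateEnergy rootEnergy)
open Summit.AtomisticToContinuum.Crystallization.Theorems.PalmUnimodularRigidityMinimiserShells.EnergyFloor
open Summit.AtomisticToContinuum.Crystallization.Theorems.MinimiserShells.Negative.LoadBearing (eStar)
open Summit.AtomisticToContinuum.Crystallization.Theorems.SlackRigidityNegative (E3 gs gs_isGroundState)
open Summit.AtomisticToContinuum.Crystallization.Theorems.SlackRigidityLawCellAverage
  (lintegral_phase_eq_cellAverage)
open Summit.AtomisticToContinuum.Crystallization.Theorems.SlackRigidityLawEnergy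
open Summit.AtomisticToContinuum.Crystallization.Theorems.SlackRigidityLawBad

/-! ## Size control: small clusters have a definite excess rate -/

/-- **Strict periodisation bound**: `e* < E(n)/n` for every `n ≥ 1` (from the strict binding
inequality `E(2n) < 2 E(n)` and `2n · e* ≤ E(2n)`). [folklore] -/
theorem lt_excessRate {n : ℕ} (hn : 0 < n) : eStar < groundStateEnergy lennardJones 3 n / n := by
  have hlt := Literature.MathematicalPhysics.StatisticalMechanics.groundStateEnergy_add_lt (d := 3)
    (by norm_num) hn hn (gs_isGroundState n) (gs_isGroundState n)
  have h2 := Summit.AtomisticToContinuum.Crystallization.Theorems.ChargedEnergyGapNegative.eStar_le_groundStateEnergy_div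
    (show 0 < n + n by omega)
  change eStar ≤ _ at h2
  have hnr : (0 : ℝ) < n := by exact_mod_cast hn
  rw [lt_div_iff₀ hnr]
  rw [le_div_iff₀ (by push_cast; linarith)] at h2
  push_cast at h2
  linarith

/-- For every size bound `M` there is `τ > 0` below the excess rate of every cluster size `n ≤ M`.
[folklore] -/
theorem exists_pos_lt_excessRate (M : ℕ) :
    ∃ τ : ℝ, 0 < τ ∧ ∀ n : ℕ, 0 < n → n ≤ M → τ < groundStateEnergy lennardJones 3 n / n - eStar := by
  induction M with
  | zero => exact ⟨1, one_pos, fun n hn hM => by omega⟩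
  | succ M ih =>
    obtain ⟨τ, hτ, h⟩ := ih
    have hγ : 0 < groundStateEnergy lennardJones 3 (M + 1) / (M + 1 : ℕ) - eStar := by
      linarith [lt_excessRate (Nat.succ_pos M)]
    refine ⟨min τ ((groundStateEnergy lennardJones 3 (M + 1) / (M + 1 : ℕ) - eStar) / 2),
      lt_min hτ (by linarith), fun n hn hle => ?_⟩
    rcases Nat.lt_or_ge n (M + 1) with hlt | hge
    · exact (min_le_left _ _).trans_lt (h n hn (by omega))
    · have hn' : n = M + 1 := le_antisymm hle hge
      subst hn'
      exact (min_le_right _ _).trans_lt (by linarith)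

/-! ## The absurd inequality -/

/-- `x/2 < x/4 + x/8` is impossible in `ℝ≥0∞` for finite `x`. [folklore] -/
theorem not_half_lt {x : ℝ≥0∞} (hx : x ≠ ∞) : ¬ x / 2 < x / 4 + x / 8 := by
  intro h
  have h4 : x / 4 ≠ ∞ := ENNReal.div_ne_top hx (by norm_num)
  have h8 : x / 8 ≠ ∞ := ENNReal.div_ne_top hx (by norm_num)
  have h2 : x / 2 ≠ ∞ := ENNReal.div_ne_top hx (by norm_num)
  have h' := (ENNReal.toReal_lt_toReal h2 (ENNReal.add_ne_top.2 ⟨h4, h8⟩)).2 h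
  rw [ENNReal.toReal_add h4 h8, ENNReal.toReal_div, ENNReal.toReal_div, ENNReal.toReal_div] at h'
  norm_num at h'
  have hx0 : 0 ≤ x.toReal := ENNReal.toReal_nonneg
  linarith

/-- **The absurd inequality**: `β D ≤ β/4 · V + K/t` is impossible when `V/2 < D`, `K ≤ t · (β V/8)`,
everything finite and `β, V, t ≠ 0`. [folklore] -/
theorem absurd_of_ineq {β V D K t : ℝ≥0∞} (hβ0 : β ≠ 0) (hβt : β ≠ ∞) (hVt : V ≠ ∞)
    (hD : V / 2 < D) (hK : K ≤ t * (β * V / 8)) (ht0 : t ≠ 0) (htt : t ≠ ∞)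
    (h : β * D ≤ β / 4 * V + K / t) : False := by
  have hKt : K / t ≤ β * V / 8 := by
    rw [ENNReal.div_le_iff_le_mul (Or.inl ht0) (Or.inl htt), mul_comm]
    exact hK
  have hlt : β * (V / 2) < β * D := by
    rw [mul_comm β (V / 2), mul_comm β D]
    exact ENNReal.mul_lt_mul_left hβ0 hβt hD
  have hx : β * V ≠ ∞ := ENNReal.mul_ne_top hβt hVt
  refine not_half_lt hx ?_
  calc β * V / 2 = β * (V / 2) := by rw [mul_div_assoc]
    _ < β * D := hlt
    _ ≤ β / 4 * V + K / t := h
    _ ≤ β * V / 4 + β * V / 8 := by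
        gcongr
        · rw [ENNReal.div_eq_inv_mul, ENNReal.div_eq_inv_mul, mul_assoc]

/-! ## The pointwise bound -/

variable {P₀ : PeriodicConfiguration 3} {R ε δ L : ℝ} {G : Set (Measure E3)}

/-- **Pointwise selection inequality.** If no cluster of size `≥ M`, energy `≤ #T e* + η #T` and bad
count `≥ b #T` exists, then at every rooted `δ`-hard-core configuration and every phase the cell
average of the bad functional is at most `ofReal b + (cellAvg f_E - c)/ofReal τ`,
`c = ofReal (e* + C_δ)`, `τ = min η τ_M`; and `c ≤ cellAvg f_E`. [folklore] -/
theorem pointwise_bound (hδ : 0 < δ) (hL : 0 < L) {M : ℕ} {η b τ : ℝ} (hτ : 0 < τ)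
    (hτη : τ ≤ η) (hsize : ∀ n : ℕ, 0 < n → n ≤ M → τ < groundStateEnergy lennardJones 3 n / n - eStar)
    (hc : -cst δ ≤ eStar)
    (hG : ∀ μ : Measure E3, IsRootedHardCore δ μ →
      (μ ∈ G ↔ ∃ A : E3 →ₗᵢ[ℝ] E3, LocallyMatches R ε (atoms μ) (A '' P₀.points)))
    (hnone : ∀ T : Finset E3, M ≤ T.card →
      interactionEnergy lennardJones (fun i : Fin T.card => ((T.equivFin.symm i : T) : E3)) ≤
        (T.card : ℝ) * eStar + η * T.card →
      (Nat.card {y : T // ¬ ∃ A : E3 →ₗᵢ[ℝ] E3,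
        LocallyMatches R ε ((fun z : E3 => z - (y : E3)) '' (T : Set E3)) (A '' P₀.points)} : ℝ) <
        b * T.card)
    {μ : Measure E3} (hμ : IsRootedHardCore δ μ) (v : E3) :
    (∫⁻ y in rootCell L v, Gᶜ.indicator (1 : Measure E3 → ℝ≥0∞) (μ.map fun z => z - y) *
        {v : E3 | ∀ i, ((⌊-v i⌋ : ℤ) : ℝ) ≤ -R / L - v i ∧ R / L - v i < ⌊-v i⌋ + 1}.indicator
          (1 : E3 → ℝ≥0∞) (v - L⁻¹ • y) ∂μ) / μ (rootCell L v) ≤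
      ENNReal.ofReal b + ((∫⁻ y in rootCell L v, ENNReal.ofReal (locEnergy δ (μ.map fun z => z - y)
        (rootCell L (v - L⁻¹ • y)) + cst δ) ∂μ) / μ (rootCell L v) - ENNReal.ofReal (eStar + cst δ)) /
        ENNReal.ofReal τ ∧
    ENNReal.ofReal (eStar + cst δ) ≤ (∫⁻ y in rootCell L v, ENNReal.ofReal (locEnergy δ (μ.map fun z => z - y)
        (rootCell L (v - L⁻¹ • y)) + cst δ) ∂μ) / μ (rootCell L v) := by
  obtain ⟨S, h0, hsep, rfl⟩ := hμ
  obtain ⟨T, hT, h0T⟩ := exists_cluster hδ hL h0 hsep v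
  have hB := cellAvg_bad_le (P₀ := P₀) (R := R) (ε := ε) (G := G) hL h0 hsep hG hT
  have hEq := cellAvg_energy_eq hδ hL h0 hsep hT
  have hcard : 0 < T.card := Finset.card_pos.2 ⟨0, h0T⟩
  have hcr : (0 : ℝ) < T.card := by exact_mod_cast hcard
  set E : ℝ := interactionEnergy lennardJones (fun i : Fin T.card => ((T.equivFin.symm i : T) : E3)) with hEdef
  set Y : ℝ := E / T.card - eStar with hYdef
  have hY : 0 ≤ Y := excess_per_particle_nonneg hcard
  have hc0 : 0 ≤ eStar + cst δ := by linarith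
  have hEq' : (∫⁻ y in rootCell L v, ENNReal.ofReal (locEnergy δ
      ((((Measure.count : Measure E3).restrict S).map fun z => z - y)) (rootCell L (v - L⁻¹ • y)) + cst δ)
      ∂((Measure.count : Measure E3).restrict S)) / ((Measure.count : Measure E3).restrict S) (rootCell L v) =
      ENNReal.ofReal Y + ENNReal.ofReal (eStar + cst δ) := by
    rw [hEq, ← ENNReal.ofReal_add hY hc0]
    congr 1
    rw [hYdef]; ring
  set q : ℝ≥0∞ := (Nat.card {y : T // ¬ ∃ A : E3 →ₗᵢ[ℝ] E3,
    LocallyMatches R ε ((fun z : E3 => z - (y : E3)) '' (T : Set E3)) (A '' P₀.points)} : ℝ≥0∞) / T.card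
    with hqdef
  have hctop : ENNReal.ofReal (eStar + cst δ) ≠ ∞ := ENNReal.ofReal_ne_top
  refine ⟨?_, by rw [hEq']; exact le_add_self⟩
  -- the case analysis
  have key : q ≤ ENNReal.ofReal b ∨ τ < Y := by
    by_cases hM : M ≤ T.card
    · by_cases hEn : E ≤ (T.card : ℝ) * eStar + η * T.card
      · left
        have hlt := hnone T hM hEn
        have hq : q = ENNReal.ofReal ((Nat.card {y : T // ¬ ∃ A : E3 →ₗᵢ[ℝ] E3,
            LocallyMatches R ε ((fun z : E3 => z - (y : E3)) '' (T : Set E3)) (A '' P₀.points)} : ℝ) /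
            T.card) := by
          rw [hqdef, ENNReal.ofReal_div_of_pos hcr, ENNReal.ofReal_natCast, ENNReal.ofReal_natCast]
        rw [hq]
        exact ENNReal.ofReal_le_ofReal ((div_lt_iff₀ hcr).2 hlt).le
      · right
        push Not at hEn
        have : eStar + η < E / T.card := by
          rw [lt_div_iff₀ hcr]; linarith
        linarith
    · right
      push Not at hM
      have hs := hsize T.card hcard hM.le
      have hge : groundStateEnergy lennardJones 3 T.card ≤ E :=
        Literature.MathematicalPhysics.StatisticalMechanics.groundStateEnergy_lennardJones_le (injective_enum T)
      have : groundStateEnergy lennardJones 3 T.card / T.card ≤ E / T.card :=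
        div_le_div_of_nonneg_right hge hcr.le
      linarith
  rcases key with hq | hYτ
  · exact hB.trans (hq.trans le_self_add)
  · have h1 : (1 : ℝ≥0∞) ≤ ((∫⁻ y in rootCell L v, ENNReal.ofReal (locEnergy δ
        ((((Measure.count : Measure E3).restrict S).map fun z => z - y)) (rootCell L (v - L⁻¹ • y)) + cst δ)
        ∂((Measure.count : Measure E3).restrict S)) / ((Measure.count : Measure E3).restrict S) (rootCell L v) -
        ENNReal.ofReal (eStar + cst δ)) / ENNReal.ofReal τ := by
      rw [hEq', ENNReal.add_sub_cancel_right hctop, ENNReal.le_div_iff_mul_le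
        (Or.inl ((ENNReal.ofReal_pos.2 hτ).ne')) (Or.inl ENNReal.ofReal_ne_top), one_mul]
      exact ENNReal.ofReal_le_ofReal hYτ.le
    have hq1 : q ≤ 1 := by
      rw [hqdef, ENNReal.div_le_iff_le_mul (Or.inl (by exact_mod_cast hcard.ne'))
        (Or.inl (ENNReal.natCast_ne_top _)), one_mul]
      exact_mod_cast (Nat.card_le_card_of_injective _ Subtype.val_injective).trans_eq (Nat.card_eq_finsetCard T)
    exact hB.trans (hq1.trans (h1.trans le_add_self))

/-! ## Integration of the pointwise bound -/

/-- **Integrated selection inequality** (inner integral): for a rooted hard-core configuration,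
`∫ cellAvg f_B dv ≤ ofReal b · V + (∫ cellAvg f_E dv - c V) / ofReal τ`. [folklore] -/
theorem setLIntegral_bound (hδ : 0 < δ) (hL : 0 < L) {M : ℕ} {η b τ : ℝ} (hτ : 0 < τ)
    (hτη : τ ≤ η) (hsize : ∀ n : ℕ, 0 < n → n ≤ M → τ < groundStateEnergy lennardJones 3 n / n - eStar)
    (hc : -cst δ ≤ eStar)
    (hG : ∀ μ : Measure E3, IsRootedHardCore δ μ →
      (μ ∈ G ↔ ∃ A : E3 →ₗᵢ[ℝ] E3, LocallyMatches R ε (atoms μ) (A '' P₀.points)))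
    (hnone : ∀ T : Finset E3, M ≤ T.card →
      interactionEnergy lennardJones (fun i : Fin T.card => ((T.equivFin.symm i : T) : E3)) ≤
        (T.card : ℝ) * eStar + η * T.card →
      (Nat.card {y : T // ¬ ∃ A : E3 →ₗᵢ[ℝ] E3,
        LocallyMatches R ε ((fun z : E3 => z - (y : E3)) '' (T : Set E3)) (A '' P₀.points)} : ℝ) <
        b * T.card)
    {μ : Measure E3} (hμ : IsRootedHardCore δ μ) :
    ∫⁻ v in phaseDom, (∫⁻ y in rootCell L v, Gᶜ.indicator (1 : Measure E3 → ℝ≥0∞) (μ.map fun z => z - y) *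
        {v : E3 | ∀ i, ((⌊-v i⌋ : ℤ) : ℝ) ≤ -R / L - v i ∧ R / L - v i < ⌊-v i⌋ + 1}.indicator
          (1 : E3 → ℝ≥0∞) (v - L⁻¹ • y) ∂μ) / μ (rootCell L v) ≤
      ENNReal.ofReal b * volume phaseDom +
        ((∫⁻ v in phaseDom, (∫⁻ y in rootCell L v, ENNReal.ofReal (locEnergy δ (μ.map fun z => z - y)
          (rootCell L (v - L⁻¹ • y)) + cst δ) ∂μ) / μ (rootCell L v)) -
          ENNReal.ofReal (eStar + cst δ) * volume phaseDom) / ENNReal.ofReal τ := by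
  have hpt := fun v => pointwise_bound (P₀ := P₀) (R := R) (ε := ε) (G := G) hδ hL hτ hτη hsize hc hG hnone hμ v
  have hτ0 : ENNReal.ofReal τ ≠ 0 := (ENNReal.ofReal_pos.2 hτ).ne'
  have hcV : ENNReal.ofReal (eStar + cst δ) * volume phaseDom ≠ ∞ :=
    ENNReal.mul_ne_top ENNReal.ofReal_ne_top volume_phaseDom_ne_top
  calc _ ≤ ∫⁻ v in phaseDom, (ENNReal.ofReal b + ((∫⁻ y in rootCell L v, ENNReal.ofReal (locEnergy δ
          (μ.map fun z => z - y) (rootCell L (v - L⁻¹ • y)) + cst δ) ∂μ) / μ (rootCell L v) -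
          ENNReal.ofReal (eStar + cst δ)) / ENNReal.ofReal τ) := lintegral_mono fun v => (hpt v).1
    _ = ENNReal.ofReal b * volume phaseDom + ∫⁻ v in phaseDom, ((∫⁻ y in rootCell L v, ENNReal.ofReal (locEnergy δ
          (μ.map fun z => z - y) (rootCell L (v - L⁻¹ • y)) + cst δ) ∂μ) / μ (rootCell L v) -
          ENNReal.ofReal (eStar + cst δ)) / ENNReal.ofReal τ := by
        rw [lintegral_add_left measurable_const, setLIntegral_const, mul_comm]
    _ = ENNReal.ofReal b * volume phaseDom + (∫⁻ v in phaseDom, ((∫⁻ y in rootCell L v, ENNReal.ofReal (locEnergy δ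
          (μ.map fun z => z - y) (rootCell L (v - L⁻¹ • y)) + cst δ) ∂μ) / μ (rootCell L v) -
          ENNReal.ofReal (eStar + cst δ))) / ENNReal.ofReal τ := by
        congr 1
        simp_rw [ENNReal.div_eq_inv_mul]
        rw [lintegral_const_mul' _ _ (ENNReal.inv_ne_top.2 hτ0)]
    _ = _ := by
        congr 2
        rw [lintegral_sub measurable_const (by rw [setLIntegral_const]; exact hcV)
          (ae_of_all _ fun v => (hpt v).2), setLIntegral_const, mul_comm]

/-! ## The selection theorem -/

/-- **Selection of a bad cluster.** For a point-stationary probability law `P`, a.s. rooted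
`δ`-hard-core, with `E_P[h] ≤ e*`, and a measurable version `G` of the `(R, ε)`-good-root event with
`P(Gᶜ) ≠ 0`, there is `b > 0` such that for every `η > 0` and every `M` some finite cluster `T` has
`#T ≥ M`, `𝓔(T) ≤ #T e* + η #T` and at least `b #T` points that are `(R, ε)`-bad within `T`.
[folklore] -/
theorem exists_badCluster (hδ : 0 < δ) (P : Measure (Measure E3)) [IsProbabilityMeasure P]
    (hcore : ∀ᵐ μ ∂P, IsRootedHardCore δ μ) (hstat : IsPointStationaryLaw P)
    (hE : (∫ μ, rootEnergy lennardJones μ ∂P) ≤ eStar) (hGm : MeasurableSet G)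
    (hG : ∀ μ : Measure E3, IsRootedHardCore δ μ →
      (μ ∈ G ↔ ∃ A : E3 →ₗᵢ[ℝ] E3, LocallyMatches R ε (atoms μ) (A '' P₀.points)))
    (hbad : P Gᶜ ≠ 0) :
    ∃ b : ℝ, 0 < b ∧ ∀ (η : ℝ) (M : ℕ), 0 < η → ∃ T : Finset E3, M ≤ T.card ∧
      interactionEnergy lennardJones (fun i : Fin T.card => ((T.equivFin.symm i : T) : E3)) ≤
        (T.card : ℝ) * eStar + η * T.card ∧
      b * T.card ≤ (Nat.card {y : T // ¬ ∃ A : E3 →ₗᵢ[ℝ] E3,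
        LocallyMatches R ε ((fun z : E3 => z - (y : E3)) '' (T : Set E3)) (A '' P₀.points)} : ℝ) := by
  set β : ℝ≥0∞ := P Gᶜ with hβdef
  have hβt : β ≠ ∞ := measure_ne_top P _
  have hβpos : 0 < β.toReal := ENNReal.toReal_pos hbad hβt
  refine ⟨β.toReal / 4, by positivity, fun η M hη => ?_⟩
  by_contra hcon
  have hnone : ∀ T : Finset E3, M ≤ T.card →
      interactionEnergy lennardJones (fun i : Fin T.card => ((T.equivFin.symm i : T) : E3)) ≤
        (T.card : ℝ) * eStar + η * T.card →
      (Nat.card {y : T // ¬ ∃ A : E3 →ₗᵢ[ℝ] E3,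
        LocallyMatches R ε ((fun z : E3 => z - (y : E3)) '' (T : Set E3)) (A '' P₀.points)} : ℝ) <
        β.toReal / 4 * T.card :=
    fun T hM hEn => lt_of_not_ge fun h' => hcon ⟨T, hM, hEn, h'⟩
  -- thresholds
  obtain ⟨τ₁, hτ₁, hsize₁⟩ := exists_pos_lt_excessRate M
  set τ : ℝ := min η τ₁ with hτdef
  have hτ : 0 < τ := lt_min hη hτ₁
  have hτη : τ ≤ η := min_le_left _ _
  have hsize : ∀ n : ℕ, 0 < n → n ≤ M → τ < groundStateEnergy lennardJones 3 n / n - eStar :=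
    fun n hn hM => (min_le_right _ _).trans_lt (hsize₁ n hn hM)
  have hc : -cst δ ≤ eStar := neg_cst_le_eStar hδ P hcore hE
  set V : ℝ≥0∞ := volume phaseDom with hVdef
  have hV0 : V ≠ 0 := volume_phaseDom_ne_zero
  have hVt : V ≠ ∞ := volume_phaseDom_ne_top
  set κ : ℝ≥0∞ := ENNReal.ofReal τ * (β * V / 8) with hκdef
  have hκ0 : 0 < κ := by
    refine pos_iff_ne_zero.2 (mul_ne_zero (ENNReal.ofReal_pos.2 hτ).ne' ?_)
    exact (ENNReal.div_pos_iff.2 ⟨mul_ne_zero hbad hV0, by norm_num⟩).ne'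
  -- choose the mesh
  have hev1 : ∀ᶠ n : ℕ in atTop, V / 2 < volume (phaseDom ∩ {v : E3 | ∀ i,
      ((⌊-v i⌋ : ℤ) : ℝ) ≤ -R / ((n : ℝ) + 1) - v i ∧ R / ((n : ℝ) + 1) - v i < ⌊-v i⌋ + 1}) :=
    (tendsto_volume_deep R).eventually (Ioi_mem_nhds (ENNReal.half_lt_self hV0 hVt))
  have hev2 : ∀ᶠ n : ℕ in atTop, ENNReal.ofReal (1 / 12) * ∫⁻ μ, errTerm ((n : ℝ) + 1) μ ∂P < κ := by
    have h := ENNReal.Tendsto.const_mul (tendsto_lintegral_errTerm hδ P hcore) (Or.inr ENNReal.ofReal_ne_top)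
      (a := ENNReal.ofReal (1 / 12))
    rw [mul_zero] at h
    exact h.eventually (Iio_mem_nhds hκ0)
  obtain ⟨n, hn1, hn2⟩ := (hev1.and hev2).exists
  set L : ℝ := (n : ℝ) + 1 with hLdef
  have hL : 0 < L := by positivity
  -- the bad identity: `β · vol(deep) = E[∫ cellAvg f_B]`
  have hBout := lintegral_badFunctional_eq hGm L R P
  have hBid := lintegral_phase_eq_cellAverage hδ hL (measurable_badFunctional hGm L R)
    (badFunctional_periodic G L R) hcore hstat
  -- the energy bound: `E[∫ cellAvg f_E] ≤ V c + κ`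
  have hEle := (lintegral_cellAvg_energy_le hδ hL P hcore hstat hE).trans (add_le_add le_rfl hn2.le)
  -- integrate the pointwise bound
  have hcV : ENNReal.ofReal (eStar + cst δ) * V ≠ ∞ := ENNReal.mul_ne_top ENNReal.ofReal_ne_top hVt
  have hτ0 : ENNReal.ofReal τ ≠ 0 := (ENNReal.ofReal_pos.2 hτ).ne'
  have hinner := fun μ (hμ : IsRootedHardCore δ μ) => setLIntegral_bound (P₀ := P₀) (R := R) (ε := ε)
    (G := G) hδ hL hτ hτη hsize hc hG hnone hμ
  have hlow : ∀ᵐ μ ∂P, ENNReal.ofReal (eStar + cst δ) * V ≤ ∫⁻ v in phaseDom, (∫⁻ y in rootCell L v,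
      ENNReal.ofReal (locEnergy δ (μ.map fun z => z - y) (rootCell L (v - L⁻¹ • y)) + cst δ) ∂μ) /
      μ (rootCell L v) := hcore.mono fun μ hμ => by
    calc ENNReal.ofReal (eStar + cst δ) * V = ∫⁻ _v in phaseDom, ENNReal.ofReal (eStar + cst δ) := by
          rw [setLIntegral_const, mul_comm]
      _ ≤ _ := lintegral_mono fun v => (pointwise_bound (P₀ := P₀) (R := R) (ε := ε) (G := G) hδ hL
          hτ hτη hsize hc hG hnone hμ v).2
  have hmain : β * volume (phaseDom ∩ {v : E3 | ∀ i, ((⌊-v i⌋ : ℤ) : ℝ) ≤ -R / L - v i ∧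
      R / L - v i < ⌊-v i⌋ + 1}) ≤ ENNReal.ofReal (β.toReal / 4) * V + κ / ENNReal.ofReal τ := by
    rw [← hBout, hBid]
    calc _ ≤ ∫⁻ μ, (ENNReal.ofReal (β.toReal / 4) * V + ((∫⁻ v in phaseDom, (∫⁻ y in rootCell L v,
            ENNReal.ofReal (locEnergy δ (μ.map fun z => z - y) (rootCell L (v - L⁻¹ • y)) + cst δ) ∂μ) /
            μ (rootCell L v)) - ENNReal.ofReal (eStar + cst δ) * V) / ENNReal.ofReal τ) ∂P :=
          lintegral_mono_ae (hcore.mono fun μ hμ => hinner μ hμ)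
      _ = ENNReal.ofReal (β.toReal / 4) * V + (∫⁻ μ, ((∫⁻ v in phaseDom, (∫⁻ y in rootCell L v,
            ENNReal.ofReal (locEnergy δ (μ.map fun z => z - y) (rootCell L (v - L⁻¹ • y)) + cst δ) ∂μ) /
            μ (rootCell L v)) - ENNReal.ofReal (eStar + cst δ) * V) ∂P) / ENNReal.ofReal τ := by
          rw [lintegral_add_left measurable_const, lintegral_const, measure_univ, mul_one]
          congr 1
          simp_rw [ENNReal.div_eq_inv_mul]
          rw [lintegral_const_mul' _ _ (ENNReal.inv_ne_top.2 hτ0)]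
      _ = ENNReal.ofReal (β.toReal / 4) * V + ((∫⁻ μ, (∫⁻ v in phaseDom, (∫⁻ y in rootCell L v,
            ENNReal.ofReal (locEnergy δ (μ.map fun z => z - y) (rootCell L (v - L⁻¹ • y)) + cst δ) ∂μ) /
            μ (rootCell L v)) ∂P) - ENNReal.ofReal (eStar + cst δ) * V) / ENNReal.ofReal τ := by
          congr 2
          rw [lintegral_sub measurable_const (by rw [lintegral_const, measure_univ, mul_one]; exact hcV) hlow,
            lintegral_const, measure_univ, mul_one]
      _ ≤ ENNReal.ofReal (β.toReal / 4) * V + κ / ENNReal.ofReal τ := by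
          gcongr
          rw [tsub_le_iff_right, add_comm, mul_comm]
          exact hEle
  -- the absurd inequality
  have hb4 : ENNReal.ofReal (β.toReal / 4) = β / 4 := by
    rw [ENNReal.ofReal_div_of_pos (by norm_num : (0 : ℝ) < 4), ENNReal.ofReal_toReal hβt,
      ENNReal.ofReal_ofNat]
  rw [hb4] at hmain
  exact absurd_of_ineq hbad hβt hVt hn1 le_rfl hτ0 ENNReal.ofReal_ne_top hmain

/-- **Registered form** (stub `badCluster_selection` of crux stmt-AtomisticToContinuum-11960): the
selection theorem with all hypotheses explicit. [folklore] -/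
theorem badCluster_selection : ∀ (P₀ : PeriodicConfiguration 3) (R ε δ : ℝ), 0 < δ → ∀ (P : Measure (Measure E3)), IsProbabilityMeasure P → (∀ᵐ μ ∂P, IsRootedHardCore δ μ) → IsPointStationaryLaw P → (∫ μ, rootEnergy lennardJones μ ∂P) ≤ eStar → ∀ (G : Set (Measure E3)), MeasurableSet G → (∀ μ : Measure E3, IsRootedHardCore δ μ → (μ ∈ G ↔ ∃ A : E3 →ₗᵢ[ℝ] E3, LocallyMatches R ε (atoms μ) (A '' P₀.points))) → P Gᶜ ≠ 0 → ∃ b : ℝ, 0 < b ∧ ∀ (η : ℝ) (M : ℕ), 0 < η → ∃ T : Finset E3, M ≤ T.card ∧ interactionEnergy lennardJones (fun i : Fin T.card => ((T.equivFin.symm i : T) : E3)) ≤ (T.card : ℝ) * eStar + η * T.card ∧ b * T.card ≤ (Nat.card {y : T // ¬ ∃ A : E3 →ₗᵢ[ℝ] E3, LocallyMatches R ε ((fun z : E3 => z - (y : E3)) '' (T : Set E3)) (A '' P₀.points)} : ℝ) :=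
  fun _ _ _ _ hδ P _ hcore hstat hE _ hGm hG hbad => exists_badCluster hδ P hcore hstat hE hGm hG hbad

end Summit.AtomisticToContinuum.Crystallization.Theorems.SlackRigidityLawSelection

end
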